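import Literature.NumberTheory.Automorphic.CuspidalContragredientProofs
import Literature.NumberTheory.Automorphic.AutomorphicRepLieActionGL
import Literature.NumberTheory.Automorphic.HarishChandraGLTwist
import Literature.NumberTheory.Automorphic.HarishChandraGLTransposeInv
import HarnessLib

/-!
# The infinity type of the contragredient of an automorphic representation of `GL_n(𝔸_K)`

Topic `NumberTheory/Automorphic`. Proofs-only file (theorems, no definitions, no named facts),
a sequel to the series `CuspidalContragredient{Involution, Arch, Forms, Hecke, Proofs}` (which
realises the contragredient of a cuspidal datum `π = W / W'` of `GL_n(𝔸_K)` on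
`π' = (W ∘ τ) / (W' ∘ τ)`, `τ(g) = w₀ ᵗg⁻¹ w₀`, and computes its Satake parameters `α ↦ α⁻¹`,
`CuspidalAutomorphicRepData.exists_contragredient_satake_holds`). Here: **the archimedean
parameter and the infinity type of `π'`**.

* `AutomorphicRepData.HasArchParameter.contragredient` — if `π` has archimedean (Harish-Chandra)
  parameter `χ_∞ : (K →+* ℂ) → Multiset ℂ`, then `π'` has parameter `σ ↦ -χ_∞(σ)` (every entry
  negated at every complex embedding): the real Lie algebra `𝔤 = 𝔤𝔩_n(K_∞)` acts on `W ∘ τ / W' ∘ τ`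
  through `X (φ ∘ τ) = ((θ X) φ) ∘ τ`, `θ(X) = -w₀ ᵗX w₀`
  (`lieDeriv_comp_weylLong_mul_glTransposeInv_mul_weylLong` of `CuspidalContragredientArch`), i.e.
  along `W / W' ≃ W ∘ τ / W' ∘ τ` (`exists_quotEquiv_of_map_funLeft_contragredient`) the action is
  `ρ ∘ θ` (`lieRep_funLeft_contragredient`); `θ` restricts on every place factor `𝔤𝔩_n(K_w)` to the
  same involution (`…_topEquiv_symm_realPlaceLie`, `…_complexPlaceLie`), under which Harish-Chandra
  parameters are negated (`HasHCParameter.comp_negRevTranspose`, `HarishChandraGLTransposeInv`).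
  On the Langlands parameter restricted to `ℂˣ ⊆ W_{K_w}`: `z^{a} z̄^{b} ↦ z^{-a} z̄^{-b}` — the
  contragredient of `π_∞` has the dual infinitesimal character (Knapp 2002, Thm. 5.44;
  Borel–Wallach 2000, I §2), as it must for `(π̃)_v ≅ (π_v)~` (Cogdell 2004, §2, Thm. 2.1 ff.).
* `AutomorphicRepData.HasInfinityType.contragredient` — consequently every well-formed infinity
  type `T'` whose `a`-multisets are the negatives of those of an infinity type `T` of `π` is an
  infinity type of `π'` (e.g. `T' σ = {(-a, -b) : (a, b) ∈ T σ}`; `HasInfinityType` only reads the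
  `a`-multisets, see `ArchimedeanGLn.HasInfinityTypeLie`).
* `CuspidalAutomorphicRepData.exists_contragredient_satake_archParameter` — **packaging**: for
  every cuspidal datum `π` there is a cuspidal datum `π'` (the contragredient, as in
  `exists_contragredient_satake_holds`) with Satake parameters `α⁻¹` wherever `π` has `α`, with
  archimedean parameter `-χ_∞` whenever `π` has `χ_∞`, and with infinity type `T'` as above whenever
  `π` has infinity type `T`. In particular the contragredient of an `L`-algebraic (resp. regular,
  `C`-algebraic) `π` is `L`-algebraic (resp. regular, `C`-algebraic).

## References

* J. W. Cogdell, *Analytic theory of L-functions for GL_n*, in: An Introduction to the Langlands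
  Program, Birkhäuser 2004, §1 (after Thm. 1.2), §2 (Thm. 2.1). [CogdellAnalyticTheory2004]
* A. W. Knapp, *Lie Groups Beyond an Introduction*, 2nd ed. (2002), §V.5, Thm. 5.44. [Knapp2002]
* A. Borel, N. Wallach, *Continuous cohomology, discrete subgroups, and representations of
  reductive groups*, 2nd ed. (2000), I §2. [BorelWallach2000]
* A. Borel, H. Jacquet, *Automorphic forms and automorphic representations*, PSPM 33.1 (1979),
  §1.5, 4.6. [BorelJacquetCorvallis1979]
* L. Clozel, *Motifs et formes automorphes* (1990), §3.3 (type à l'infini). [Clozel1990]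
-/

noncomputable section

open scoped MatrixGroups Matrix NNReal Classical ContDiff
open NumberField IsDedekindDomain

namespace Literature.NumberTheory.Automorphic

open GaloisRepresentations (glTransposeInv coe_glTransposeInv_apply)

-- Mathlib idiom (Mathlib/Algebra/Lie/OfAssociative.lean), as in `RealMatrixGroups`, `AutomorphicForms`,
-- `CuspidalContragredientArch`: the commutator Lie ring on matrices, needed to name the Lie algebra of
-- the archimedean group and its place factors in statements.
attribute [local instance 100] LieRing.ofAssociativeRing

/-! ### Conjugation by `w₀` on matrices over any commutative ring -/

section WeylConj

variable {n : ℕ}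

/-- `(w₀ M w₀)_{ij} = M_{rev i, rev j}` for the long Weyl element `w₀` (the permutation matrix of
`Fin.rev`) over any commutative ring. [folklore] -/
theorem coe_weylLong_mul_mul_coe_weylLong_apply {R : Type*} [CommRing R] (M : Matrix (Fin n) (Fin n) R)
    (i j : Fin n) :
    (((weylLong n R : GL (Fin n) R) : Matrix (Fin n) (Fin n) R) * M *
      ((weylLong n R : GL (Fin n) R) : Matrix (Fin n) (Fin n) R)) i j = M i.rev j.rev := by
  rw [coe_weylLong]
  have h1 : (Fin.revPerm.permMatrix R : Matrix (Fin n) (Fin n) R) * M = M.submatrix Fin.revPerm id :=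
    PEquiv.toMatrix_toPEquiv_mul _ _
  have h2 : M.submatrix Fin.revPerm id * (Fin.revPerm.permMatrix R : Matrix (Fin n) (Fin n) R) =
      (M.submatrix Fin.revPerm id).submatrix id Fin.revPerm.symm :=
    PEquiv.mul_toMatrix_toPEquiv _ _
  rw [h1, h2]
  simp only [Matrix.submatrix_apply, id_eq, Fin.revPerm_symm, Fin.revPerm_apply]

end WeylConj

variable {n : ℕ} {K : Type} [Field K] [NumberField K] {hcpt : isCompact_glFiniteIntegralLevel n K}

local notation "𝕂∞" => mixedEmbedding.mixedSpace K
local notation "𝒟" => AutomorphyDatum.gl n K hcpt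
local notation "τ𝔸[" g "]" => weylLong n (AdeleRing (𝓞 K) K) *
  glTransposeInv (Fin n) (AdeleRing (𝓞 K) K) g * weylLong n (AdeleRing (𝓞 K) K)
-- precomposition with `τ` as a linear endomorphism of the functions on `GL_n(𝔸_K)`
set_option quotPrecheck false in
local notation "τ𝔸⋆" => LinearMap.funLeft ℂ ℂ (m := (AdelicGroupData.gl n K).Adelic)
  (n := (AdelicGroupData.gl n K).Adelic) fun g => τ𝔸[g]

/-! ### `θ` on the place factors of `𝔤𝔩_n(K_∞)` -/

section PlaceFactors

variable (θ : (AutomorphyDatum.gl n K hcpt).arch.lie →ₗ⁅ℝ⁆ (AutomorphyDatum.gl n K hcpt).arch.lie)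
  (hθ : ∀ X : (AutomorphyDatum.gl n K hcpt).arch.lie,
    ((θ X : (AutomorphyDatum.gl n K hcpt).arch.lie) :
        Matrix (Fin n) (Fin n) (mixedEmbedding.mixedSpace K)) =
      -(((weylLong n (mixedEmbedding.mixedSpace K) : GL (Fin n) (mixedEmbedding.mixedSpace K)) :
          Matrix (Fin n) (Fin n) (mixedEmbedding.mixedSpace K)) *
        (X : Matrix (Fin n) (Fin n) (mixedEmbedding.mixedSpace K))ᵀ *
        ((weylLong n (mixedEmbedding.mixedSpace K) : GL (Fin n) (mixedEmbedding.mixedSpace K)) :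
          Matrix (Fin n) (Fin n) (mixedEmbedding.mixedSpace K))))
include hθ

/-- Entries of `θ X` in `𝔤𝔩_n(K_∞)`: `(θ X)_{ij} = -X_{rev j, rev i}`. [folklore] -/
theorem coe_lieHom_neg_weylLong_transpose_apply (X : (𝒟).arch.lie) (i j : Fin n) :
    ((θ X : (𝒟).arch.lie) : Matrix (Fin n) (Fin n) 𝕂∞) i j = -(X : Matrix (Fin n) (Fin n) 𝕂∞) j.rev i.rev := by
  rw [hθ, Matrix.neg_apply, coe_weylLong_mul_mul_coe_weylLong_apply, Matrix.transpose_apply]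

omit [NumberField K] hθ in
/-- The underlying matrix of `topEquiv.symm Z` is `Z`. [folklore] -/
theorem coe_topEquiv_symm (Z : Matrix (Fin n) (Fin n) 𝕂∞) :
    (((LieSubalgebra.topEquiv :
        (⊤ : LieSubalgebra ℝ (Matrix (Fin n) (Fin n) 𝕂∞)) ≃ₗ⁅ℝ⁆ Matrix (Fin n) (Fin n) 𝕂∞).symm Z :
        (⊤ : LieSubalgebra ℝ (Matrix (Fin n) (Fin n) 𝕂∞))) : Matrix (Fin n) (Fin n) 𝕂∞) = Z := by
  rw [← LieSubalgebra.topEquiv_apply (LieSubalgebra.topEquiv.symm Z), LieEquiv.apply_symm_apply]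

/-- **`θ` on a complex place factor**: `θ (ι_w Y) = ι_w (θ_ℂ Y)` for the inclusion
`ι_w = complexPlaceLie n w : 𝔤𝔩_n(ℂ) ↪ 𝔤𝔩_n(K_∞)` and the involution `θ_ℂ(Y) = -w₀ ᵗY w₀` of
`𝔤𝔩_n(ℂ)` (both are computed entrywise). [folklore] -/
theorem lieHom_neg_weylLong_transpose_topEquiv_symm_complexPlaceLie
    (θ' : Matrix (Fin n) (Fin n) ℂ →ₗ⁅ℝ⁆ Matrix (Fin n) (Fin n) ℂ)
    (hθ' : ∀ Y, θ' Y = -((Fin.revPerm.permMatrix ℂ : Matrix (Fin n) (Fin n) ℂ) * Yᵀ *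
      (Fin.revPerm.permMatrix ℂ : Matrix (Fin n) (Fin n) ℂ)))
    (w : {w : InfinitePlace K // InfinitePlace.IsComplex w}) (Y : Matrix (Fin n) (Fin n) ℂ) :
    θ ((LieSubalgebra.topEquiv :
        (⊤ : LieSubalgebra ℝ (Matrix (Fin n) (Fin n) 𝕂∞)) ≃ₗ⁅ℝ⁆ Matrix (Fin n) (Fin n) 𝕂∞).symm
          (complexPlaceLie n w Y)) =
      (LieSubalgebra.topEquiv :
        (⊤ : LieSubalgebra ℝ (Matrix (Fin n) (Fin n) 𝕂∞)) ≃ₗ⁅ℝ⁆ Matrix (Fin n) (Fin n) 𝕂∞).symm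
          (complexPlaceLie n w (θ' Y)) := by
  refine Subtype.ext ?_
  rw [coe_topEquiv_symm]
  refine Matrix.ext fun i j => ?_
  rw [coe_lieHom_neg_weylLong_transpose_apply θ hθ, coe_topEquiv_symm, complexPlaceLie_apply,
    complexPlaceLie_apply, negRevTranspose_apply θ' hθ', Prod.neg_mk, neg_zero, Pi.single_neg]

/-- **`θ` on a real place factor**: `θ (ι_w Y) = ι_w (θ_ℝ Y)` for
`ι_w = realPlaceLie n w : 𝔤𝔩_n(ℝ) ↪ 𝔤𝔩_n(K_∞)`. [folklore] -/
theorem lieHom_neg_weylLong_transpose_topEquiv_symm_realPlaceLie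
    (θ' : Matrix (Fin n) (Fin n) ℝ →ₗ⁅ℝ⁆ Matrix (Fin n) (Fin n) ℝ)
    (hθ' : ∀ Y, θ' Y = -((Fin.revPerm.permMatrix ℝ : Matrix (Fin n) (Fin n) ℝ) * Yᵀ *
      (Fin.revPerm.permMatrix ℝ : Matrix (Fin n) (Fin n) ℝ)))
    (w : {w : InfinitePlace K // InfinitePlace.IsReal w}) (Y : Matrix (Fin n) (Fin n) ℝ) :
    θ ((LieSubalgebra.topEquiv :
        (⊤ : LieSubalgebra ℝ (Matrix (Fin n) (Fin n) 𝕂∞)) ≃ₗ⁅ℝ⁆ Matrix (Fin n) (Fin n) 𝕂∞).symm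
          (realPlaceLie n w Y)) =
      (LieSubalgebra.topEquiv :
        (⊤ : LieSubalgebra ℝ (Matrix (Fin n) (Fin n) 𝕂∞)) ≃ₗ⁅ℝ⁆ Matrix (Fin n) (Fin n) 𝕂∞).symm
          (realPlaceLie n w (θ' Y)) := by
  refine Subtype.ext ?_
  rw [coe_topEquiv_symm]
  refine Matrix.ext fun i j => ?_
  rw [coe_lieHom_neg_weylLong_transpose_apply θ hθ, coe_topEquiv_symm, realPlaceLie_apply,
    realPlaceLie_apply, negRevTranspose_apply θ' hθ', Prod.neg_mk, neg_zero, Pi.single_neg]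

end PlaceFactors

/-! ### `W / W' ≃ W ∘ τ / W' ∘ τ` and the Lie algebra action on the contragredient datum -/

namespace AutomorphicRepData

/-- **Precomposition with `τ` identifies the quotients**: if `π'.W = π.W ∘ τ` and
`π'.W' = π.W' ∘ τ` (`τ⋆` is injective, indeed involutive), then `φ ↦ φ ∘ τ` induces a linear
isomorphism `W / W' ≃ W ∘ τ / W' ∘ τ` carrying `[φ]` to `[φ ∘ τ]`. Borel–Jacquet 1979, 4.6. [folklore] -/
theorem exists_quotEquiv_of_map_funLeft_contragredient
    {π π' : AutomorphicRepData (AutomorphyDatum.gl n K hcpt)}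
    (hW : π'.W = π.W.map τ𝔸⋆) (hW' : π'.W' = π.W'.map τ𝔸⋆) :
    ∃ e : π.Quot ≃ₗ[ℂ] π'.Quot, ∀ φ : π.W,
      e (π.mkQ φ) = π'.mkQ ⟨τ𝔸⋆ φ, hW ▸ Submodule.mem_map_of_mem φ.2⟩ := by
  have hinj : Function.Injective (τ𝔸⋆ : ((AdelicGroupData.gl n K).Adelic → ℂ) →ₗ[ℂ]
      ((AdelicGroupData.gl n K).Adelic → ℂ)) :=
    Function.Involutive.injective funLeft_weylLong_mul_glTransposeInv_mul_weylLong_involutive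
  obtain ⟨e₁, he₁⟩ : ∃ e₁ : π.W ≃ₗ[ℂ] π'.W,
      ∀ φ : π.W, ((e₁ φ : π'.W) : (AdelicGroupData.gl n K).Adelic → ℂ) = τ𝔸⋆ φ :=
    ⟨(Submodule.equivMapOfInjective _ hinj π.W).trans (LinearEquiv.ofEq _ _ hW.symm), fun φ => rfl⟩
  have hker : π.kerQuot.map (e₁ : π.W →ₗ[ℂ] π'.W) = π'.kerQuot := by
    ext ψ
    simp only [Submodule.mem_map, AutomorphicRepData.kerQuot, Submodule.mem_comap,
      Submodule.subtype_apply, LinearEquiv.coe_coe]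
    constructor
    · rintro ⟨φ, hφ, rfl⟩
      rw [he₁, hW']
      exact Submodule.mem_map_of_mem hφ
    · intro hψ
      rw [hW', Submodule.mem_map] at hψ
      obtain ⟨φ₀, hφ₀, hφ₀ψ⟩ := hψ
      refine ⟨⟨φ₀, π.lt.le hφ₀⟩, hφ₀, Subtype.ext ?_⟩
      rw [he₁]
      exact hφ₀ψ
  refine ⟨Submodule.Quotient.equiv π.kerQuot π'.kerQuot e₁ hker, fun φ => ?_⟩
  have h2 : (e₁ : π.W →ₗ[ℂ] π'.W) φ = ⟨τ𝔸⋆ φ, hW ▸ Submodule.mem_map_of_mem φ.2⟩ :=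
    Subtype.ext (he₁ φ)
  have h3 : Submodule.Quotient.equiv π.kerQuot π'.kerQuot e₁ hker (Submodule.Quotient.mk φ) =
      Submodule.Quotient.mk ((e₁ : π.W →ₗ[ℂ] π'.W) φ) :=
    rfl
  calc _ = Submodule.Quotient.mk ((e₁ : π.W →ₗ[ℂ] π'.W) φ) := h3
    _ = _ := by rw [h2]; rfl

/-- **The Lie algebra acts on `W ∘ τ / W' ∘ τ` through `θ`**: along the isomorphism `e` of
`exists_quotEquiv_of_map_funLeft_contragredient` and for the Lie action `ρ` of `π`,
`π'.lieRep X (e v) = e (ρ (θ X) v)` — since `X (φ ∘ τ) = ((θ X) φ) ∘ τ`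
(`lieDeriv_comp_weylLong_mul_glTransposeInv_mul_weylLong`). Borel–Jacquet 1979, §1.5 and 4.6;
Cogdell 2004, §2. [folklore] -/
theorem lieRep_funLeft_contragredient
    (θ : (AutomorphyDatum.gl n K hcpt).arch.lie →ₗ⁅ℝ⁆ (AutomorphyDatum.gl n K hcpt).arch.lie)
    (hθ : ∀ X : (AutomorphyDatum.gl n K hcpt).arch.lie,
      ((θ X : (AutomorphyDatum.gl n K hcpt).arch.lie) :
          Matrix (Fin n) (Fin n) (mixedEmbedding.mixedSpace K)) =
        -(((weylLong n (mixedEmbedding.mixedSpace K) : GL (Fin n) (mixedEmbedding.mixedSpace K)) :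
            Matrix (Fin n) (Fin n) (mixedEmbedding.mixedSpace K)) *
          (X : Matrix (Fin n) (Fin n) (mixedEmbedding.mixedSpace K))ᵀ *
          ((weylLong n (mixedEmbedding.mixedSpace K) : GL (Fin n) (mixedEmbedding.mixedSpace K)) :
            Matrix (Fin n) (Fin n) (mixedEmbedding.mixedSpace K))))
    {π π' : AutomorphicRepData (AutomorphyDatum.gl n K hcpt)} (hW : π'.W = π.W.map τ𝔸⋆)
    {e : π.Quot ≃ₗ[ℂ] π'.Quot}
    (he : ∀ φ : π.W, e (π.mkQ φ) = π'.mkQ ⟨τ𝔸⋆ φ, hW ▸ Submodule.mem_map_of_mem φ.2⟩)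
    {ρ : (AutomorphyDatum.gl n K hcpt).arch.lie →ₗ⁅ℝ⁆ Module.End ℂ π.Quot} (hρ : π.HasLieAction ρ)
    (X : (AutomorphyDatum.gl n K hcpt).arch.lie) (v : π.Quot) :
    π'.lieRep X (e v) = e (ρ (θ X) v) := by
  induction v using Submodule.Quotient.induction_on with
  | H φ =>
  have hmk : (Submodule.Quotient.mk φ : π.Quot) = π.mkQ φ := rfl
  rw [hmk, he, π'.lieRep_mkQ, hρ (θ X) φ, he]
  congr 1
  exact Subtype.ext (lieDeriv_comp_weylLong_mul_glTransposeInv_mul_weylLong θ hθ X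
    (φ : (AdelicGroupData.gl n K).Adelic → ℂ) (hcpt := hcpt))

/-- **The archimedean parameter of the contragredient datum `π' = (W ∘ τ) / (W' ∘ τ)`** is
`σ ↦ -χ_∞(σ)` if `π = W / W'` has archimedean parameter `χ_∞`: every Harish-Chandra entry at every
complex embedding is negated (`z^a z̄^b ↦ z^{-a} z̄^{-b}` on `ℂˣ ⊆ W_{K_w}`). The Lie algebra acts on
`π'` through `θ(X) = -w₀ ᵗX w₀` along `W / W' ≃ W ∘ τ / W' ∘ τ` (`lieRep_funLeft_contragredient`),
`θ` preserves each place factor (`…_topEquiv_symm_realPlaceLie/complexPlaceLie`), and on a factor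
`𝔤𝔩_n(K_w)` precomposition with `θ` negates the Harish-Chandra parameter
(`HasHCParameter.comp_negRevTranspose`). Knapp 2002, Thm. 5.44; Borel–Wallach 2000, I §2;
Cogdell 2004, §2 (`(π̃)_v ≅ (π_v)~`). [cite: Knapp2002, §V.5 Thm. 5.44] -/
theorem HasArchParameter.contragredient {π π' : AutomorphicRepData (AutomorphyDatum.gl n K hcpt)}
    (hW : π'.W = π.W.map τ𝔸⋆) (hW' : π'.W' = π.W'.map τ𝔸⋆)
    {χ : (K →+* ℂ) → Multiset ℂ} (h : π.HasArchParameter χ) :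
    π'.HasArchParameter fun σ => (χ σ).map Neg.neg := by
  obtain ⟨θ, hθ⟩ := exists_lieHom_neg_weylLong_transpose (hcpt := hcpt) (n := n) (K := K)
  obtain ⟨ρ, hρ, hreal, hcx⟩ := h
  obtain ⟨e, he⟩ := exists_quotEquiv_of_map_funLeft_contragredient hW hW'
  have hrel := fun X v => lieRep_funLeft_contragredient θ hθ hW he hρ X v
  obtain ⟨θr, hθr⟩ := exists_lieHom_negRevTranspose (𝕜 := ℝ) (n := n)
  obtain ⟨θc, hθc⟩ := exists_lieHom_negRevTranspose (𝕜 := ℂ) (n := n)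
  refine ⟨π'.lieRep, π'.hasLieAction_lieRep, fun w => ?_, fun w => ?_⟩
  · -- real place `w`
    have h1 := HasHCParameter.comp_negRevTranspose θr hθr
      (ρ := (ρ.comp (LieSubalgebra.topEquiv :
        (⊤ : LieSubalgebra ℝ (Matrix (Fin n) (Fin n) 𝕂∞)) ≃ₗ⁅ℝ⁆
          Matrix (Fin n) (Fin n) 𝕂∞).symm.toLieHom).comp (realPlaceLie n w))
      (ρ' := ((ρ.comp (LieSubalgebra.topEquiv :
        (⊤ : LieSubalgebra ℝ (Matrix (Fin n) (Fin n) 𝕂∞)) ≃ₗ⁅ℝ⁆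
          Matrix (Fin n) (Fin n) 𝕂∞).symm.toLieHom).comp (realPlaceLie n w)).comp θr)
      (fun Y => rfl) (hreal w)
    refine HasHCParameter.of_conj e (fun Y v => ?_) h1
    simp only [LieHom.comp_apply]
    rw [hrel]
    congr 2
    exact congrArg ρ (lieHom_neg_weylLong_transpose_topEquiv_symm_realPlaceLie θ hθ θr hθr w Y)
  · -- complex place `w`
    have h1 := HasHCParameter.comp_negRevTranspose θc hθc
      (ρ := (ρ.comp (LieSubalgebra.topEquiv :
        (⊤ : LieSubalgebra ℝ (Matrix (Fin n) (Fin n) 𝕂∞)) ≃ₗ⁅ℝ⁆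
          Matrix (Fin n) (Fin n) 𝕂∞).symm.toLieHom).comp (complexPlaceLie n w))
      (ρ' := ((ρ.comp (LieSubalgebra.topEquiv :
        (⊤ : LieSubalgebra ℝ (Matrix (Fin n) (Fin n) 𝕂∞)) ≃ₗ⁅ℝ⁆
          Matrix (Fin n) (Fin n) 𝕂∞).symm.toLieHom).comp (complexPlaceLie n w)).comp θc)
      (fun Y => rfl) (hcx w)
    refine HasHCParameter.of_conj e (fun Y v => ?_) h1
    simp only [LieHom.comp_apply]
    rw [hrel]
    congr 2
    exact congrArg ρ (lieHom_neg_weylLong_transpose_topEquiv_symm_complexPlaceLie θ hθ θc hθc w Y)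

/-- **Infinity types of the contragredient datum.** If `π = W / W'` has infinity type `T`, then
every well-formed `T'` whose `a`-multisets are the negatives of those of `T` — e.g.
`T' σ = {(-a, -b) : (a, b) ∈ T σ}` — is an infinity type of `π' = (W ∘ τ) / (W' ∘ τ)`
(`HasInfinityType` reads only the `a`-multisets). In particular `π'` is `L`-algebraic / regular /
`C`-algebraic with `π`. Clozel 1990, §3.3; Buzzard–Gee 2014, §3.1. [cite: Clozel1990, §3.3] -/
theorem HasInfinityType.contragredient {π π' : AutomorphicRepData (AutomorphyDatum.gl n K hcpt)}
    (hW : π'.W = π.W.map τ𝔸⋆) (hW' : π'.W' = π.W'.map τ𝔸⋆)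
    {T T' : InfinityType K n} (hT : π.HasInfinityType T) (hT' : T'.IsWellFormed)
    (ha : ∀ σ, (T' σ).map ArchWeight.a = ((T σ).map ArchWeight.a).map Neg.neg) :
    π'.HasInfinityType T' := by
  refine ⟨hT', ?_⟩
  have e : (fun σ => (T' σ).map ArchWeight.a) = fun σ => ((T σ).map ArchWeight.a).map Neg.neg :=
    funext ha
  rw [e]
  exact HasArchParameter.contragredient hW hW' hT.2

end AutomorphicRepData

/-! ### Packaging: the contragredient datum with its Satake parameters and infinity type -/

/-- **The contragredient of a cuspidal automorphic representation of `GL_n(𝔸_K)`: Satake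
parameters AND infinity type.** For every cuspidal datum `π = W / W'` there is a cuspidal datum
`π'` — the contragredient `(W ∘ τ) / (W' ∘ τ)` of `exists_contragredient_satake_holds` — such that
(i) wherever `π` has Satake parameter `α`, `π'` has Satake parameter `α⁻¹` (Getz–Hahn 2024,
Prop. 7.6.2); (ii) whenever `π` has archimedean parameter `χ_∞`, `π'` has `-χ_∞`; (iii) whenever
`π` has infinity type `T`, `π'` has every well-formed infinity type `T'` with negated `a`-multisets
(`T' σ = {(-a, -b)}`). Cogdell 2004, §2, Thm. 2.1 (`π̃` is cuspidal automorphic, realised on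
`φ(ᵗg⁻¹)`), with the archimedean computation of Knapp 2002, Thm. 5.44.
[cite: CogdellAnalyticTheory2004, §2 Thm. 2.1 and §1 after Thm. 1.2] -/
theorem CuspidalAutomorphicRepData.exists_contragredient_satake_archParameter
    (hcpt : isCompact_glFiniteIntegralLevel n K) (π : CuspidalAutomorphicRepData n K hcpt) :
    ∃ π' : CuspidalAutomorphicRepData n K hcpt,
      (∀ (v : HeightOneSpectrum (𝓞 K)) (α : Multiset ℂ),
        π.1.HasSatakeParamAt v α → π'.1.HasSatakeParamAt v (α.map (·⁻¹))) ∧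
      (∀ χ : (K →+* ℂ) → Multiset ℂ,
        π.1.HasArchParameter χ → π'.1.HasArchParameter fun σ => (χ σ).map Neg.neg) ∧
      ∀ T T' : InfinityType K n, π.1.HasInfinityType T → T'.IsWellFormed →
        (∀ σ, (T' σ).map ArchWeight.a = ((T σ).map ArchWeight.a).map Neg.neg) →
          π'.1.HasInfinityType T' := by
  refine ⟨⟨{ W := π.1.W.map τ𝔸⋆
             W' := π.1.W'.map τ𝔸⋆
             lt := map_funLeft_weylLong_mul_glTransposeInv_mul_weylLong_lt π.1.lt
             stable := π.1.stable.map_funLeft_weylLong_mul_glTransposeInv_mul_weylLong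
             stable' := π.1.stable'.map_funLeft_weylLong_mul_glTransposeInv_mul_weylLong
             irreducible :=
               irreducible_map_funLeft_weylLong_mul_glTransposeInv_mul_weylLong π.1.irreducible },
      (Submodule.map_mono π.2).trans map_funLeft_weylLong_mul_glTransposeInv_mul_weylLong_cuspFormsGL_le⟩,
    fun v α hα => ?_, fun χ hχ => ?_, fun T T' hT hT' ha => ?_⟩
  · exact hasSatakeParamAt_map_funLeft_weylLong_mul_glTransposeInv_mul_weylLong π.1.stable' hα
  · exact AutomorphicRepData.HasArchParameter.contragredient rfl rfl hχ
  · exact AutomorphicRepData.HasInfinityType.contragredient rfl rfl hT hT' ha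

end Literature.NumberTheory.Automorphic
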